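import Summits.BirchSwinnertonDyer.BirchSwinnertonDyer.Theorems.PrintCFramBottomClassIndexLawFiveLeSelmerCountCaseSLocalLine
import Summits.BirchSwinnertonDyer.BirchSwinnertonDyer.Theorems.PrintCFramBottomClassIndexLawFiveLeSelmerDevissageLocalCriterionLevel
import HarnessLib

/-!
# Route `PrintCFram`, crux C2 `BottomClassIndexLawFiveLe` (stmt-BirchSwinnertonDyer-20372), line
# `eisenstein-resource-bdp-line` (registry v19/v20): **THE LOCAL KUMMER CRITERION AT ONE POINT** — (LA)/(LT) are decided by ANY ONE local
# point outside `pW(ℚ_p)`, in particular by a rational point of LEVEL `0`; the small-Selmer branch of B1 as a certificate on the GENERATOR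
# (cell `bsd-print-cfram`, width seat `bsd-line-cfram-p1-w6` g4; helper `--supports` 20372; 0 defs, 0 facts, 0 sorry)

HONEST FRAMING. Nothing about BSD is proved unconditionally here and no stub is closed. Sequel of `…SelmerDevissageLocalCriterion` (§2: the
local dichotomy (LA) ∨ (LT) and its exclusivity from `W(ℚ_v)[p] = 0`), `…Level` (the `ℚ_v ↔ ℚ_[p]` bridge) and `…SelmerCountCaseSLocalLine`
(CASE S_loc from one line). Notation as there; `AR(Φ, P)` := «`P` has a `Φ`-adapted `p`-th root at `v`».

* §0 `forall_smul_eq_neg_of_cyclotomicFactor` / `forall_smul_eq_self_of_cyclotomicFactor` — the sign hypotheses from the rational line's shape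
  `θ_S = b ∘ χ_m` (`exists_rationalLineData_of_hss`): `b(−1) = −1` ⟹ every complex conjugation is `−1` on the line, `b(−1) = 1` ⟹ `+1`.
* §1 **`forall_exists_adaptedRoot_iff_of_forall_ne`**, **`forall_imp_iff_of_forall_ne`** — if `W(ℚ_v)[p] = 0` and `P₀ ∈ W(ℚ_v)` is NOT
  `p`-divisible, then (LA)(Φ) ⟺ `AR(Φ, P₀)` and (LT)(Φ) ⟺ `¬ AR(Φ, P₀)` (the quotient `W(ℚ_v)/p` has prime order, so one point off `pW(ℚ_v)`
  decides the case).
* §2 **`forall_exists_adaptedRoot_iff_of_level_zero`**, **`forall_imp_iff_of_level_zero`** — the same with `P₀` the image of a rational point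
  `P ∈ W(ℚ)` of LEVEL `0` in the crux's currency (`∀ Q : W(ℚ_[p]), p • Q ≠ toPadicPoint p P`; on the Kriz–Li locus the generator has level `0`,
  w6 g3 `level_eq_zero_of_unit_classFactor`); `…_of_cmRamified` versions with `W(ℚ_v)[p] = 0` discharged on the class.
* §3 THE CERTIFICATE ON THE GENERATOR: **`bsdp_iff_shaAnUnit_of_odd_line_of_not_adaptedRoot`** — class member, `‖B_{1,ψ⁻¹}‖ = p⁻¹`, ONE odd
  stable line `Φ₀`, ONE rational point `g` of LEVEL `0` WITHOUT a `Φ₀`-adapted `p`-th root at `p` ⟹ `Ш(W)[p] = 0`-branch reading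
  `BSDp W p ↔ p ∤ #Ш_an(W)` (mod MW Thm 2 / Cassels–Tate / GZK / `r_an = 1`); **`bsdp_iff_shaAnUnit_of_even_line_of_adaptedRoot`** — dually with an
  even line and a LEVEL-`0` point WITH a `Φ₀`-adapted root; and the `Ш(W)[p] = 0` twins. This is the sharpest form of «CASE S is member data»:
  one line, its sign, and ONE `p`-division question about the generator in `W(ℚ̄_p)`.

THEOREMS ONLY; no definition, no named fact, no `sorry`. BSD is not proved by any of this; no summit statement is proved by this seat. References:
[SilvermanAEC2009] X.§4 (diagram (**), Rem. 4.7); [MilneADT2006] I Lemma 3.3; seat notes w2g9 §3, w6g4.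
-/

set_option autoImplicit false
-- `…BirchSwinnertonDyer.BirchSwinnertonDyer.Theorems…` is the problem's mandated namespace (D-0017).
set_option linter.dupNamespace false

noncomputable section

open scoped Classical

namespace Summit.BirchSwinnertonDyer.BirchSwinnertonDyer.Theorems.PrintCFram.SelmerCount

open NumberField IsDedekindDomain Field WeierstrassCurve DirichletCharacter
open Literature.NumberTheory.NumberFields Literature.NumberTheory.EllipticCurves Literature.NumberTheory.GaloisRepresentations
  Literature.NumberTheory.EllipticCurves.GreenbergSelmer Literature.NumberTheory.EllipticCurves.Rank1Residual
  Literature.NumberTheory.EllipticCurves.KrizLi2019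
open Summit.BirchSwinnertonDyer.Rank1Residual Summit.BirchSwinnertonDyer.Rank1Residual.X2.ResidualDevissageModules
open Summit.BirchSwinnertonDyer.BirchSwinnertonDyer.Theorems.PrintCFram.LevelDictionary

variable {p : ℕ} [hp : Fact p.Prime]
variable (W : WeierstrassCurve ℚ) [W.IsElliptic]

/-! ## §0 The sign of a line from its cyclotomic factor -/

section LineSign

variable (Φ : StableSubgroup (absoluteGaloisGroup ℚ) (geomTorsion W (p : ℤ)))

omit [W.IsElliptic] in
/-- **Every complex conjugation acts by `−1` on a line whose character is `b ∘ χ_m` with `b(−1) = −1`** (the shape `θ_S = b ∘ χ_m` of w6 g3's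
`LevelDictionaryAlpha.exists_rationalLineData_of_hss`; `χ_m(c) = −1` for every complex conjugation `c`,
`modNCyclotomicCharacter_of_isComplexConjugation`). The hypothesis `hodd` of `caseS_local_of_odd_line` / §3 below.
[cite: Washington1997, Thm. 14.1 (Kronecker–Weber)] -/
theorem forall_smul_eq_neg_of_cyclotomicFactor (hcard : Nat.card Φ.Sub = p) (θ : absoluteGaloisGroup ℚ →* (ZMod p)ˣ)
    (hθ : ∀ (g : absoluteGaloisGroup ℚ) (x : Φ.Sub), g • x = (((θ g : ZMod p).val : ℕ) : ℤ) • x)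
    {m : ℕ} [NeZero m] (b : (ZMod m)ˣ →* (ZMod p)ˣ) (hθb : ∀ τ : absoluteGaloisGroup ℚ, θ τ = b (modNCyclotomicCharacter ℚ m τ))
    (hb : b (-1) = -1) (c : absoluteGaloisGroup ℚ) (hc : IsComplexConjugation (Rat.castHom ℝ) c) (x : Φ.Sub) :
    c • x = -x := by
  have hmc : modNCyclotomicCharacter ℚ m c = -1 :=
    Units.ext (by rw [Units.val_neg, Units.val_one]; exact modNCyclotomicCharacter_of_isComplexConjugation hc)
  exact smul_eq_neg_of_apply_eq_neg_one hcard θ hθ (by rw [hθb c, hmc, hb]) x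

omit [W.IsElliptic] in
/-- **Every complex conjugation fixes a line whose character is `b ∘ χ_m` with `b(−1) = 1`.** The hypothesis `heven` of
`caseS_local_of_even_line` / §3 below. [cite: Washington1997, Thm. 14.1 (Kronecker–Weber)] -/
theorem forall_smul_eq_self_of_cyclotomicFactor (θ : absoluteGaloisGroup ℚ →* (ZMod p)ˣ)
    (hθ : ∀ (g : absoluteGaloisGroup ℚ) (x : Φ.Sub), g • x = (((θ g : ZMod p).val : ℕ) : ℤ) • x)
    {m : ℕ} [NeZero m] (b : (ZMod m)ˣ →* (ZMod p)ˣ) (hθb : ∀ τ : absoluteGaloisGroup ℚ, θ τ = b (modNCyclotomicCharacter ℚ m τ))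
    (hb : b (-1) = 1) (c : absoluteGaloisGroup ℚ) (hc : IsComplexConjugation (Rat.castHom ℝ) c) (x : Φ.Sub) :
    c • x = x := by
  have hmc : modNCyclotomicCharacter ℚ m c = -1 :=
    Units.ext (by rw [Units.val_neg, Units.val_one]; exact modNCyclotomicCharacter_of_isComplexConjugation hc)
  exact smul_eq_self_of_apply_eq_one θ hθ (by rw [hθb c, hmc, hb]) x

end LineSign

/-! ## §1 One point off `pW(ℚ_v)` decides the case -/

section OnePoint

variable (v : HeightOneSpectrum (𝓞 ℚ)) (Φ : StableSubgroup (absoluteGaloisGroup ℚ) (geomTorsion W (p : ℤ)))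

/-- **(LA)(Φ) ⟺ one non-`p`-divisible local point has a `Φ`-adapted root.** If `W(ℚ_v)[p] = 0` (`v ∣ p`) and `P₀ ∈ W(ℚ_v)` is not
`p`-divisible in `W(ℚ_v)`, then every rational local point has a `Φ`-adapted `p`-th root iff `P₀` has one (dichotomy + exclusivity of
`…SelmerDevissageLocalCriterion` §2). [cite: MilneADT2006, I Lemma 3.3] [cite: SilvermanAEC2009, X.§4 (diagram (**), Rem. 4.7)] -/
theorem forall_exists_adaptedRoot_iff_of_forall_ne (hpv : ((p : ℕ) : 𝓞 ℚ) ∈ v.asIdeal)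
    (htors : Nat.card (nsmulAddMonoidHom p :
      (W.baseChange (v.adicCompletion ℚ)).toAffine.Point →+ _).ker = 1)
    (P₀ : (W.baseChange (v.adicCompletion ℚ)).toAffine.Point)
    (hP₀ : ∀ S : (W.baseChange (v.adicCompletion ℚ)).toAffine.Point, p • S ≠ P₀) :
    (∀ P : (W.baseChange (v.adicCompletion ℚ)).toAffine.Point,
      ∃ R : localPoints W (v.adicCompletion ℚ),
        (p : ℤ) • R = Affine.Point.map (W' := W)
          (IsScalarTower.toAlgHom ℚ (v.adicCompletion ℚ) (AlgebraicClosure (v.adicCompletion ℚ))) P ∧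
        ∀ σ : absoluteGaloisGroup (v.adicCompletion ℚ), ∃ t ∈ Φ.toAddSubgroup,
          σ • R - R = pointsMap W (v.adicCompletion ℚ) (t : geomPoints W)) ↔
    ∃ R : localPoints W (v.adicCompletion ℚ),
        (p : ℤ) • R = Affine.Point.map (W' := W)
          (IsScalarTower.toAlgHom ℚ (v.adicCompletion ℚ) (AlgebraicClosure (v.adicCompletion ℚ))) P₀ ∧
        ∀ σ : absoluteGaloisGroup (v.adicCompletion ℚ), ∃ t ∈ Φ.toAddSubgroup,
          σ • R - R = pointsMap W (v.adicCompletion ℚ) (t : geomPoints W) := by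
  refine ⟨fun hLA ↦ hLA P₀, fun hAR ↦ ?_⟩
  rcases forall_exists_adaptedRoot_or_forall_imp W v Φ hpv htors with hLA | hLT
  · exact hLA
  · obtain ⟨S, hS⟩ := hLT P₀ hAR
    exact absurd hS (hP₀ S)

/-- **(LT)(Φ) ⟺ one non-`p`-divisible local point has NO `Φ`-adapted root** (same hypotheses).
[cite: MilneADT2006, I Lemma 3.3] [cite: SilvermanAEC2009, X.§4 (diagram (**), Rem. 4.7)] -/
theorem forall_imp_iff_of_forall_ne (hpv : ((p : ℕ) : 𝓞 ℚ) ∈ v.asIdeal)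
    (htors : Nat.card (nsmulAddMonoidHom p :
      (W.baseChange (v.adicCompletion ℚ)).toAffine.Point →+ _).ker = 1)
    (P₀ : (W.baseChange (v.adicCompletion ℚ)).toAffine.Point)
    (hP₀ : ∀ S : (W.baseChange (v.adicCompletion ℚ)).toAffine.Point, p • S ≠ P₀) :
    (∀ P : (W.baseChange (v.adicCompletion ℚ)).toAffine.Point,
      (∃ R : localPoints W (v.adicCompletion ℚ),
        (p : ℤ) • R = Affine.Point.map (W' := W)
          (IsScalarTower.toAlgHom ℚ (v.adicCompletion ℚ) (AlgebraicClosure (v.adicCompletion ℚ))) P ∧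
        ∀ σ : absoluteGaloisGroup (v.adicCompletion ℚ), ∃ t ∈ Φ.toAddSubgroup,
          σ • R - R = pointsMap W (v.adicCompletion ℚ) (t : geomPoints W)) →
      ∃ S : (W.baseChange (v.adicCompletion ℚ)).toAffine.Point, p • S = P) ↔
    ¬ ∃ R : localPoints W (v.adicCompletion ℚ),
        (p : ℤ) • R = Affine.Point.map (W' := W)
          (IsScalarTower.toAlgHom ℚ (v.adicCompletion ℚ) (AlgebraicClosure (v.adicCompletion ℚ))) P₀ ∧
        ∀ σ : absoluteGaloisGroup (v.adicCompletion ℚ), ∃ t ∈ Φ.toAddSubgroup,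
          σ • R - R = pointsMap W (v.adicCompletion ℚ) (t : geomPoints W) := by
  refine ⟨fun hLT hAR ↦ ?_, fun hnAR ↦ ?_⟩
  · obtain ⟨S, hS⟩ := hLT P₀ hAR
    exact hP₀ S hS
  · rcases forall_exists_adaptedRoot_or_forall_imp W v Φ hpv htors with hLA | hLT
    · exact absurd (hLA P₀) hnAR
    · exact hLT

end OnePoint

/-! ## §2 A rational point of LEVEL `0` decides the case -/

section LevelZero

variable (v : HeightOneSpectrum (𝓞 ℚ)) (Φ : StableSubgroup (absoluteGaloisGroup ℚ) (geomTorsion W (p : ℤ)))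

omit [W.IsElliptic] in
/-- A rational point of LEVEL `0` (`∀ Q : W(ℚ_[p]), p • Q ≠ toPadicPoint p P`) is not `p`-divisible in `W(ℚ_v)` (`v ∣ p`), by the `ℚ_v → ℚ_[p]`
bridge `exists_toPadicPoint_eq_of_baseChange_eq_nsmul`. [folklore] -/
theorem forall_nsmul_ne_baseChange_of_level_zero (hpv : ((p : ℕ) : 𝓞 ℚ) ∈ v.asIdeal) (P : W.toAffine.Point)
    (hlev : ∀ Q : (W.baseChange ℚ_[p]).toAffine.Point, p • Q ≠ W.toPadicPoint p P) :
    ∀ S : (W.baseChange (v.adicCompletion ℚ)).toAffine.Point,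
      p • S ≠ Affine.Point.baseChange (W' := W) ℚ (v.adicCompletion ℚ) P := by
  intro S hS
  obtain ⟨Q, hQ⟩ := exists_toPadicPoint_eq_of_baseChange_eq_nsmul W v hpv P hS
  exact hlev Q hQ

/-- **(LA)(Φ) ⟺ the LEVEL-`0` rational point `P` has a `Φ`-adapted root at `v`** (`W(ℚ_v)[p] = 0`).
[cite: SilvermanAEC2009, X.§4 (diagram (**), Rem. 4.7)] -/
theorem forall_exists_adaptedRoot_iff_of_level_zero (hpv : ((p : ℕ) : 𝓞 ℚ) ∈ v.asIdeal)
    (htors : Nat.card (nsmulAddMonoidHom p :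
      (W.baseChange (v.adicCompletion ℚ)).toAffine.Point →+ _).ker = 1)
    (P : W.toAffine.Point) (hlev : ∀ Q : (W.baseChange ℚ_[p]).toAffine.Point, p • Q ≠ W.toPadicPoint p P) :
    (∀ P' : (W.baseChange (v.adicCompletion ℚ)).toAffine.Point,
      ∃ R : localPoints W (v.adicCompletion ℚ),
        (p : ℤ) • R = Affine.Point.map (W' := W)
          (IsScalarTower.toAlgHom ℚ (v.adicCompletion ℚ) (AlgebraicClosure (v.adicCompletion ℚ))) P' ∧
        ∀ σ : absoluteGaloisGroup (v.adicCompletion ℚ), ∃ t ∈ Φ.toAddSubgroup,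
          σ • R - R = pointsMap W (v.adicCompletion ℚ) (t : geomPoints W)) ↔
    ∃ R : localPoints W (v.adicCompletion ℚ),
        (p : ℤ) • R = pointsMap W (v.adicCompletion ℚ) (toGeomPoints W P) ∧
        ∀ σ : absoluteGaloisGroup (v.adicCompletion ℚ), ∃ t ∈ Φ.toAddSubgroup,
          σ • R - R = pointsMap W (v.adicCompletion ℚ) (t : geomPoints W) := by
  have hjP := map_toAlgHom_baseChange_eq_pointsMap W (v.adicCompletion ℚ) P
  refine (forall_exists_adaptedRoot_iff_of_forall_ne W v Φ hpv htors _
    (forall_nsmul_ne_baseChange_of_level_zero W v hpv P hlev)).trans ⟨?_, ?_⟩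
  · rintro ⟨R, hR, hRΦ⟩; exact ⟨R, hR.trans hjP, hRΦ⟩
  · rintro ⟨R, hR, hRΦ⟩; exact ⟨R, hR.trans hjP.symm, hRΦ⟩

/-- **(LT)(Φ) ⟺ the LEVEL-`0` rational point `P` has NO `Φ`-adapted root at `v`** (`W(ℚ_v)[p] = 0`).
[cite: SilvermanAEC2009, X.§4 (diagram (**), Rem. 4.7)] -/
theorem forall_imp_iff_of_level_zero (hpv : ((p : ℕ) : 𝓞 ℚ) ∈ v.asIdeal)
    (htors : Nat.card (nsmulAddMonoidHom p :
      (W.baseChange (v.adicCompletion ℚ)).toAffine.Point →+ _).ker = 1)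
    (P : W.toAffine.Point) (hlev : ∀ Q : (W.baseChange ℚ_[p]).toAffine.Point, p • Q ≠ W.toPadicPoint p P) :
    (∀ P' : (W.baseChange (v.adicCompletion ℚ)).toAffine.Point,
      (∃ R : localPoints W (v.adicCompletion ℚ),
        (p : ℤ) • R = Affine.Point.map (W' := W)
          (IsScalarTower.toAlgHom ℚ (v.adicCompletion ℚ) (AlgebraicClosure (v.adicCompletion ℚ))) P' ∧
        ∀ σ : absoluteGaloisGroup (v.adicCompletion ℚ), ∃ t ∈ Φ.toAddSubgroup,
          σ • R - R = pointsMap W (v.adicCompletion ℚ) (t : geomPoints W)) →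
      ∃ S : (W.baseChange (v.adicCompletion ℚ)).toAffine.Point, p • S = P') ↔
    ¬ ∃ R : localPoints W (v.adicCompletion ℚ),
        (p : ℤ) • R = pointsMap W (v.adicCompletion ℚ) (toGeomPoints W P) ∧
        ∀ σ : absoluteGaloisGroup (v.adicCompletion ℚ), ∃ t ∈ Φ.toAddSubgroup,
          σ • R - R = pointsMap W (v.adicCompletion ℚ) (t : geomPoints W) := by
  have hjP := map_toAlgHom_baseChange_eq_pointsMap W (v.adicCompletion ℚ) P
  refine (forall_imp_iff_of_forall_ne W v Φ hpv htors _
    (forall_nsmul_ne_baseChange_of_level_zero W v hpv P hlev)).trans (not_congr ⟨?_, ?_⟩)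
  · rintro ⟨R, hR, hRΦ⟩; exact ⟨R, hR.trans hjP, hRΦ⟩
  · rintro ⟨R, hR, hRΦ⟩; exact ⟨R, hR.trans hjP.symm, hRΦ⟩

end LevelZero

/-! ## §3 The certificate on the generator -/

section Certificate

variable [W.IsGloballyMinimal]

/-- **ODD line ∧ LEVEL-`0` point WITHOUT adapted root ∧ `‖B_{1,ψ⁻¹}‖ = p⁻¹` ⟹ `Ш(W)[p] = 0`** (+ hMW, hCT, hGZK, `r_an = 1`): on the class
`W(ℚ_v)[p] = 0` (`natCard_ker_nsmul_adicCompletion_eq_one_of_cmRamified`), so «no `Φ₀`-adapted root of the LEVEL-`0` point `g`» IS (LT)(Φ₀)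
(`forall_imp_iff_of_level_zero`), and `sha_noPTorsion_of_odd_line_of_forall_imp` applies.
[cite: MazurWiles1984, Thm. 2 (p. 214)] [cite: Cassels1962ArithmeticIV] -/
theorem sha_noPTorsion_of_odd_line_of_not_adaptedRoot (hMW : MazurWiles1984.thm2_card_oddChiClassGroup_eq_bernoulli)
    (hCT : exists_casselsTate_pairing (K := ℚ)) (hGZK : rank_eq_analyticRank_of_analyticRank_le_one)
    (hCM : W.HasCM) (hram : CMRamified W p) (h5 : 5 ≤ p) (hr : W.analyticRank = 1)
    {f : ℕ} [NeZero f] (ψ : DirichletCharacter ℚ_[p] f) (ω : DirichletCharacter ℚ_[p] p)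
    (hψ : ψ.Odd) (hω : IsTeichmullerCharacter ω)
    (hss : ∀ ℓ : ℕ, ℓ.Prime → ¬ (ℓ ∣ p * W.conductorNorm ℤ) →
      ‖((W.LFunction ℓ : ℤ) : ℚ_[p]) - (ψ (ℓ : ZMod f) + ψ⁻¹ (ℓ : ZMod f) * ω (ℓ : ZMod p))‖ < 1)
    (hB : ‖bernoulliOnePrim ψ⁻¹‖ = (p : ℝ)⁻¹)
    {v : HeightOneSpectrum (𝓞 ℚ)} (hpv : ((p : ℕ) : 𝓞 ℚ) ∈ v.asIdeal)
    (Φ₀ : StableSubgroup (absoluteGaloisGroup ℚ) (geomTorsion W (p : ℤ))) (hcard₀ : Nat.card Φ₀.Sub = p)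
    (hodd : ∀ c : absoluteGaloisGroup ℚ, IsComplexConjugation (Rat.castHom ℝ) c → ∀ x : Φ₀.Sub, c • x = -x)
    (g : W.toAffine.Point) (hlev : ∀ Q : (W.baseChange ℚ_[p]).toAffine.Point, p • Q ≠ W.toPadicPoint p g)
    (hng : ¬ ∃ R : localPoints W (v.adicCompletion ℚ),
        (p : ℤ) • R = pointsMap W (v.adicCompletion ℚ) (toGeomPoints W g) ∧
        ∀ σ : absoluteGaloisGroup (v.adicCompletion ℚ), ∃ t ∈ Φ₀.toAddSubgroup,
          σ • R - R = pointsMap W (v.adicCompletion ℚ) (t : geomPoints W)) :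
    ∀ x : W.sha, (p : ℤ) • x = 0 → x = 0 :=
  sha_noPTorsion_of_odd_line_of_forall_imp W hMW hCT hGZK hCM hram h5 hr ψ ω hψ hω hss hB hpv Φ₀ hcard₀ hodd
    ((forall_imp_iff_of_level_zero W v Φ₀ hpv
      (natCard_ker_nsmul_adicCompletion_eq_one_of_cmRamified W hCM h5 hram hpv) g hlev).mpr hng)

/-- **ODD line ∧ LEVEL-`0` point WITHOUT adapted root ∧ `‖B_{1,ψ⁻¹}‖ = p⁻¹` ⟹ (`BSDp W p ↔ p ∤ #Ш_an(W)`)** (+ hMW, hCT, hGZK, `r_an = 1`).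
[cite: MazurWiles1984, Thm. 2 (p. 214)] [cite: Cassels1962ArithmeticIV] [cite: Miller2011LMS, Def. 1.1] -/
theorem bsdp_iff_shaAnUnit_of_odd_line_of_not_adaptedRoot (hMW : MazurWiles1984.thm2_card_oddChiClassGroup_eq_bernoulli)
    (hCT : exists_casselsTate_pairing (K := ℚ)) (hGZK : rank_eq_analyticRank_of_analyticRank_le_one)
    (hCM : W.HasCM) (hram : CMRamified W p) (h5 : 5 ≤ p) (hr : W.analyticRank = 1)
    {f : ℕ} [NeZero f] (ψ : DirichletCharacter ℚ_[p] f) (ω : DirichletCharacter ℚ_[p] p)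
    (hψ : ψ.Odd) (hω : IsTeichmullerCharacter ω)
    (hss : ∀ ℓ : ℕ, ℓ.Prime → ¬ (ℓ ∣ p * W.conductorNorm ℤ) →
      ‖((W.LFunction ℓ : ℤ) : ℚ_[p]) - (ψ (ℓ : ZMod f) + ψ⁻¹ (ℓ : ZMod f) * ω (ℓ : ZMod p))‖ < 1)
    (hB : ‖bernoulliOnePrim ψ⁻¹‖ = (p : ℝ)⁻¹)
    {v : HeightOneSpectrum (𝓞 ℚ)} (hpv : ((p : ℕ) : 𝓞 ℚ) ∈ v.asIdeal)
    (Φ₀ : StableSubgroup (absoluteGaloisGroup ℚ) (geomTorsion W (p : ℤ))) (hcard₀ : Nat.card Φ₀.Sub = p)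
    (hodd : ∀ c : absoluteGaloisGroup ℚ, IsComplexConjugation (Rat.castHom ℝ) c → ∀ x : Φ₀.Sub, c • x = -x)
    (g : W.toAffine.Point) (hlev : ∀ Q : (W.baseChange ℚ_[p]).toAffine.Point, p • Q ≠ W.toPadicPoint p g)
    (hng : ¬ ∃ R : localPoints W (v.adicCompletion ℚ),
        (p : ℤ) • R = pointsMap W (v.adicCompletion ℚ) (toGeomPoints W g) ∧
        ∀ σ : absoluteGaloisGroup (v.adicCompletion ℚ), ∃ t ∈ Φ₀.toAddSubgroup,
          σ • R - R = pointsMap W (v.adicCompletion ℚ) (t : geomPoints W)) :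
    BSDp W p ↔ ∃ q : ℚ, shaAn W = (q : ℂ) ∧ padicValRat p q = 0 :=
  bsdp_iff_shaAnUnit_of_odd_line_of_forall_imp W hMW hCT hGZK hCM hram h5 hr ψ ω hψ hω hss hB hpv Φ₀ hcard₀ hodd
    ((forall_imp_iff_of_level_zero W v Φ₀ hpv
      (natCard_ker_nsmul_adicCompletion_eq_one_of_cmRamified W hCM h5 hram hpv) g hlev).mpr hng)

/-- **EVEN line ∧ LEVEL-`0` point WITH adapted root ∧ `‖B_{1,ψ⁻¹}‖ = p⁻¹` ⟹ `Ш(W)[p] = 0`** (+ hMW, hCT, hGZK, `r_an = 1`).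
[cite: MazurWiles1984, Thm. 2 (p. 214)] [cite: Cassels1962ArithmeticIV] -/
theorem sha_noPTorsion_of_even_line_of_adaptedRoot (hMW : MazurWiles1984.thm2_card_oddChiClassGroup_eq_bernoulli)
    (hCT : exists_casselsTate_pairing (K := ℚ)) (hGZK : rank_eq_analyticRank_of_analyticRank_le_one)
    (hCM : W.HasCM) (hram : CMRamified W p) (h5 : 5 ≤ p) (hr : W.analyticRank = 1)
    {f : ℕ} [NeZero f] (ψ : DirichletCharacter ℚ_[p] f) (ω : DirichletCharacter ℚ_[p] p)
    (hψ : ψ.Odd) (hω : IsTeichmullerCharacter ω)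
    (hss : ∀ ℓ : ℕ, ℓ.Prime → ¬ (ℓ ∣ p * W.conductorNorm ℤ) →
      ‖((W.LFunction ℓ : ℤ) : ℚ_[p]) - (ψ (ℓ : ZMod f) + ψ⁻¹ (ℓ : ZMod f) * ω (ℓ : ZMod p))‖ < 1)
    (hB : ‖bernoulliOnePrim ψ⁻¹‖ = (p : ℝ)⁻¹)
    {v : HeightOneSpectrum (𝓞 ℚ)} (hpv : ((p : ℕ) : 𝓞 ℚ) ∈ v.asIdeal)
    (Φ₀ : StableSubgroup (absoluteGaloisGroup ℚ) (geomTorsion W (p : ℤ))) (hcard₀ : Nat.card Φ₀.Sub = p)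
    (heven : ∀ c : absoluteGaloisGroup ℚ, IsComplexConjugation (Rat.castHom ℝ) c → ∀ x : Φ₀.Sub, c • x = x)
    (g : W.toAffine.Point) (hlev : ∀ Q : (W.baseChange ℚ_[p]).toAffine.Point, p • Q ≠ W.toPadicPoint p g)
    (hg : ∃ R : localPoints W (v.adicCompletion ℚ),
        (p : ℤ) • R = pointsMap W (v.adicCompletion ℚ) (toGeomPoints W g) ∧
        ∀ σ : absoluteGaloisGroup (v.adicCompletion ℚ), ∃ t ∈ Φ₀.toAddSubgroup,
          σ • R - R = pointsMap W (v.adicCompletion ℚ) (t : geomPoints W)) :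
    ∀ x : W.sha, (p : ℤ) • x = 0 → x = 0 :=
  sha_noPTorsion_of_even_line_of_forall_exists W hMW hCT hGZK hCM hram h5 hr ψ ω hψ hω hss hB hpv Φ₀ hcard₀ heven
    ((forall_exists_adaptedRoot_iff_of_level_zero W v Φ₀ hpv
      (natCard_ker_nsmul_adicCompletion_eq_one_of_cmRamified W hCM h5 hram hpv) g hlev).mpr hg)

/-- **EVEN line ∧ LEVEL-`0` point WITH adapted root ∧ `‖B_{1,ψ⁻¹}‖ = p⁻¹` ⟹ (`BSDp W p ↔ p ∤ #Ш_an(W)`)** (+ hMW, hCT, hGZK, `r_an = 1`).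
[cite: MazurWiles1984, Thm. 2 (p. 214)] [cite: Cassels1962ArithmeticIV] [cite: Miller2011LMS, Def. 1.1] -/
theorem bsdp_iff_shaAnUnit_of_even_line_of_adaptedRoot (hMW : MazurWiles1984.thm2_card_oddChiClassGroup_eq_bernoulli)
    (hCT : exists_casselsTate_pairing (K := ℚ)) (hGZK : rank_eq_analyticRank_of_analyticRank_le_one)
    (hCM : W.HasCM) (hram : CMRamified W p) (h5 : 5 ≤ p) (hr : W.analyticRank = 1)
    {f : ℕ} [NeZero f] (ψ : DirichletCharacter ℚ_[p] f) (ω : DirichletCharacter ℚ_[p] p)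
    (hψ : ψ.Odd) (hω : IsTeichmullerCharacter ω)
    (hss : ∀ ℓ : ℕ, ℓ.Prime → ¬ (ℓ ∣ p * W.conductorNorm ℤ) →
      ‖((W.LFunction ℓ : ℤ) : ℚ_[p]) - (ψ (ℓ : ZMod f) + ψ⁻¹ (ℓ : ZMod f) * ω (ℓ : ZMod p))‖ < 1)
    (hB : ‖bernoulliOnePrim ψ⁻¹‖ = (p : ℝ)⁻¹)
    {v : HeightOneSpectrum (𝓞 ℚ)} (hpv : ((p : ℕ) : 𝓞 ℚ) ∈ v.asIdeal)
    (Φ₀ : StableSubgroup (absoluteGaloisGroup ℚ) (geomTorsion W (p : ℤ))) (hcard₀ : Nat.card Φ₀.Sub = p)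
    (heven : ∀ c : absoluteGaloisGroup ℚ, IsComplexConjugation (Rat.castHom ℝ) c → ∀ x : Φ₀.Sub, c • x = x)
    (g : W.toAffine.Point) (hlev : ∀ Q : (W.baseChange ℚ_[p]).toAffine.Point, p • Q ≠ W.toPadicPoint p g)
    (hg : ∃ R : localPoints W (v.adicCompletion ℚ),
        (p : ℤ) • R = pointsMap W (v.adicCompletion ℚ) (toGeomPoints W g) ∧
        ∀ σ : absoluteGaloisGroup (v.adicCompletion ℚ), ∃ t ∈ Φ₀.toAddSubgroup,
          σ • R - R = pointsMap W (v.adicCompletion ℚ) (t : geomPoints W)) :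
    BSDp W p ↔ ∃ q : ℚ, shaAn W = (q : ℂ) ∧ padicValRat p q = 0 :=
  bsdp_iff_shaAnUnit_of_even_line_of_forall_exists W hMW hCT hGZK hCM hram h5 hr ψ ω hψ hω hss hB hpv Φ₀ hcard₀ heven
    ((forall_exists_adaptedRoot_iff_of_level_zero W v Φ₀ hpv
      (natCard_ker_nsmul_adicCompletion_eq_one_of_cmRamified W hCM h5 hram hpv) g hlev).mpr hg)

end Certificate

end Summit.BirchSwinnertonDyer.BirchSwinnertonDyer.Theorems.PrintCFram.SelmerCount

end
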